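import Literature.IUT.HodgeArakelov.GaussianSplittingMonoids

/-!
# [IUTchI] Ex 3.2 (iv) `q̲_v := q_v^{1/2l}` vs `q_v`: comparison of the splitting monoids generated by a root and by
# its power (proof-only)

Proof-only companion (abc-iut cell, layer L6; abc-iut-L6-t2) of `SplittingMonoidValues.lean` (p407350) and
`GaussianSplittingMonoids.lean` (p407745). Print generates the splitting monoids by the `2l`-th ROOT
`q̲_v := q_v^{1/2l}` of the `q`-parameter ([IUTchI] Ex 3.2 (iv) p. 71 "`q̲_v := q_v^{1/2l} ∈ 𝒪^▷(T_{X̲_v})`";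
[IUTchII] Rmk 2.5.1 (i) p. 72 "the theta value `q̲_v^{j²}`"), while some consumers work with the Tate parameter
`q_v` itself and carry the root in a coefficient `1/2l` (abc-iut-L6-t4's `ThetaPilotObjectsReal`, advisory A1 of
abc-iut-L6-d3, 2026-08-25). This file records the elementary comparison, for ANY element `r` with `r^n = q` of a
commutative monoid (`n = 2l` in print):

* `splittingMonoidAt_le_of_pow_eq`: `μ_{2l} · q^{j²·ℕ} ≤ μ_{2l} · r^{j²·ℕ}`;
* `valueProfileOf_eq_pow_of_pow_eq`: the value-profile of `q` with torsion `ζ_i^n` is the `n`-th power of the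
  value-profile of `r` with torsion `ζ_i` (in particular for the torsion-free profiles, `ζ ≡ 1`);
* `gaussianSplittingMonoid_le_of_pow_eq`: `μ_{2l}^{diag} · ξ(q)^ℕ ≤ μ_{2l}^{diag} · ξ(r)^ℕ` for such profiles.

So statements "up to torsion / about generators up to torsion" transfer between the two conventions, and a
consumer mixing them has the inclusion in the kernel. Claim key `Mochizuki2012` DISPUTED (D-0012): elementary
monoid algebra; nothing here asserts a disputed claim.
-/

namespace Literature.IUT.HodgeArakelov

universe u v

section Root

variable {K : Type u} [CommMonoid K]

/-- **`μ_{2l}·q^{j²ℕ} ⊆ μ_{2l}·r^{j²ℕ}` when `r^n = q`** ([IUTchI] Ex 3.2 (iv): `r = q̲_v`, `n = 2l`, `q = q_v`): the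
splitting monoid generated by the `q`-parameter lies in the one generated by its `2l`-th root.
[cite: Mochizuki2012, Ex 3.2 (iv) p.71] -/
theorem splittingMonoidAt_le_of_pow_eq {twoL n : ℕ} {q r : K} (h : r ^ n = q) (j : ℕ) :
    splittingMonoidAt K twoL q j ≤ splittingMonoidAt K twoL r j := by
  intro x hx
  rw [mem_splittingMonoidAt_iff] at hx ⊢
  obtain ⟨ζ, hζ, m, rfl⟩ := hx
  refine ⟨ζ, hζ, n * m, ?_⟩
  rw [← h, ← pow_mul, ← pow_mul, ← pow_mul]
  congr 2
  ring

/-- The theta value `q^{j²}` itself lies in `μ_{2l} · r^{j²·ℕ}` when `r^n = q`. [cite: Mochizuki2012, Rmk 2.5.1 (i) p.72] -/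
theorem thetaPower_mem_splittingMonoidAt_of_pow_eq {twoL n : ℕ} {q r : K} (h : r ^ n = q) (j : ℕ) :
    q ^ j ^ 2 ∈ splittingMonoidAt K twoL r j :=
  splittingMonoidAt_le_of_pow_eq h j (thetaPower_mem_splittingMonoidAt twoL q j)

variable {ι : Type v}

/-- **Value-profiles under the root convention**: if `r^n = q` and the torsion parts satisfy `ζ_i = ζ'_i^n`, then
the value-profile `(ζ_i · q^{e i})_i` is the `n`-th power of `(ζ'_i · r^{e i})_i` ([IUTchII] Cor 3.5 (ii) p. 94
value-profiles; [IUTchI] Ex 3.2 (iv)). [cite: Mochizuki2012, Cor 3.5 (ii) p.94] -/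
theorem valueProfileOf_eq_pow_of_pow_eq {n : ℕ} {q r : K} (h : r ^ n = q) (e : ι → ℕ) {ζ ζ' : ι → Kˣ}
    (hζ : ∀ i, ζ i = ζ' i ^ n) : valueProfileOf q e ζ = valueProfileOf r e ζ' ^ n := by
  funext i
  rw [Pi.pow_apply, valueProfileOf_apply, valueProfileOf_apply, hζ i, Units.val_pow_eq_pow_val, mul_pow, ← h,
    ← pow_mul, ← pow_mul, mul_comm n (e i)]

/-- In particular for the torsion-free profiles (`ζ ≡ 1`): `(q^{e i})_i = ((r^{e i})_i)^n`.
[cite: Mochizuki2012, Cor 3.5 (ii) p.94] -/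
theorem valueProfileOf_one_eq_pow_of_pow_eq {n : ℕ} {q r : K} (h : r ^ n = q) (e : ι → ℕ) :
    valueProfileOf q e (1 : ι → Kˣ) = valueProfileOf r e (1 : ι → Kˣ) ^ n :=
  valueProfileOf_eq_pow_of_pow_eq h e fun i => by simp

/-- **`μ_{2l}^{diag}·ξ(q)^ℕ ⊆ μ_{2l}^{diag}·ξ(r)^ℕ`**: the tuple-level splitting monoid of a profile that is the `n`-th
power of another lies in the latter's ([IUTchII] Cor 3.5 (iii) p. 95 splitting of `Ψ_ξ`; root convention of
[IUTchI] Ex 3.2 (iv)). [cite: Mochizuki2012, Cor 3.5 (iii) p.95] -/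
theorem gaussianSplittingMonoid_le_of_eq_pow {twoL n : ℕ} {ξ ξ' : ι → K} (h : ξ = ξ' ^ n) :
    gaussianSplittingMonoid K twoL ξ ≤ gaussianSplittingMonoid K twoL ξ' := by
  intro x hx
  rw [mem_gaussianSplittingMonoid_iff] at hx ⊢
  obtain ⟨ω, hω, m, rfl⟩ := hx
  refine ⟨ω, hω, n * m, funext fun i => ?_⟩
  rw [h, Pi.pow_apply, ← pow_mul]

/-- The same for the value-profiles of `q` and of its root `r` (`r^n = q`) with compatible torsion `ζ = ζ'^n`.
[cite: Mochizuki2012, Cor 3.5 (iii) p.95] -/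
theorem gaussianSplittingMonoid_le_of_pow_eq {twoL n : ℕ} {q r : K} (h : r ^ n = q) (e : ι → ℕ)
    {ζ ζ' : ι → Kˣ} (hζ : ∀ i, ζ i = ζ' i ^ n) :
    gaussianSplittingMonoid K twoL (valueProfileOf q e ζ) ≤ gaussianSplittingMonoid K twoL (valueProfileOf r e ζ') :=
  gaussianSplittingMonoid_le_of_eq_pow (valueProfileOf_eq_pow_of_pow_eq h e hζ)

/-- And for the torsion-free profiles. [cite: Mochizuki2012, Cor 3.5 (iii) p.95] -/
theorem gaussianSplittingMonoid_one_le_of_pow_eq {twoL n : ℕ} {q r : K} (h : r ^ n = q) (e : ι → ℕ) :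
    gaussianSplittingMonoid K twoL (valueProfileOf q e (1 : ι → Kˣ)) ≤
      gaussianSplittingMonoid K twoL (valueProfileOf r e (1 : ι → Kˣ)) :=
  gaussianSplittingMonoid_le_of_eq_pow (valueProfileOf_one_eq_pow_of_pow_eq h e)

end Root

end Literature.IUT.HodgeArakelov
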